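import Literature.MathematicalPhysics.KineticTheory.HardSphereCampbellWindowBounds
import Literature.MathematicalPhysics.KineticTheory.HardSphereCampbellWindows
import Literature.MathematicalPhysics.KineticTheory.HardSphereCampbellAEMeasurable
import Literature.MathematicalPhysics.KineticTheory.HardSphereCampbellHitPieceDynamics
import HarnessLib

/-!
# The lower bound of the Campbell identity at a fixed mesh

Input of the LOWER bound `LB` of the assembly `hardSphereCampbellFormula_dim_of` of the stationary
collision-rate (Campbell / special-flow) identity `HardSphereCampbellFormula`
(Cercignani–Illner–Pulvirenti 1994, App. 4.A). For the hard-sphere flow on `T^d` (`0 < ε < 1/2`), a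
measurable mark `g ≥ 0`, a window `(0, τ]`, a speed bound `V` and a mesh `δ = τ/(m+1)` fine enough
for the chart (`ε + 8Vδ < 1/2`):

`∫ CPS_{(0,τ]}(g) dLiouville ≥ τ · Σ_{a<b} ∫ dz ∫ dω ε^{d-1}⟪ω, v_a − v_b⟫
    (1_{E ≤ V²/2, other pairs farther than ε + 8Vδ} · (g(·,a,b) + g(·,b,a)))(z^{ab}_ω)`
(`campbell_lowerBound_mesh`): stationarity reduces the window to `(m+1)` copies of `(0, δ]`
(`campbell_lintegral_collisionPairSum_windows`: `collisionPairSum_windows`, measure preservation, a.e.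
measurability), on `(0, δ]` the collision pair sum dominates the marks of the collisions predicted by
the (disjoint) hit pieces (`campbell_sum_hitPiece_indicator_le_collisionPairSum`:
`collisionPairSum_ge_of_mem_hitPiece`), and each hit-piece integral is bounded below by the sharp
one-window bound `campbell_lintegral_hitPiece_shell_ge`.

## References

* C. Cercignani, R. Illner, M. Pulvirenti, *The Mathematical Theory of Dilute Gases*, Springer
  (1994), §4.2, App. 4.A pp. 107–111.
* I. Gallagher, L. Saint-Raymond, B. Texier, *From Newton to Boltzmann*, EMS (2013), proof of
  Prop. 4.1.1 p. 19.
-/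

open MeasureTheory Set Function Filter Metric
open scoped ENNReal NNReal RealInnerProductSpace

namespace Literature.MathematicalPhysics.KineticTheory

open Literature.Analysis.FluidPDE

noncomputable section

variable {d : Type*} [Fintype d] {N : ℕ} {ε : ℝ}

/-! ### Stationarity: the window as `m + 1` copies of `(0, δ]` -/

/-- **Stationarity of the collision side**: for `δ ≥ 0` and `m`,
`∫ CPS_{(0,(m+1)δ]}(g) dLiouville = (m + 1) ∫ CPS_{(0,δ]}(g) dLiouville` (window decomposition along
good orbits, `collisionPairSum_windows`; each window start `Φ_{wδ}` preserves the Liouville measure,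
and the collision pair sum is a.e.-measurable). [folklore] -/
theorem campbell_lintegral_collisionPairSum_windows (hε : 0 < ε) (hε' : ε < 1 / 2)
    (Φ : HardSphereFlow (Torus.geometry d) ε N)
    {g : Config N d (UnitAddTorus d) → Fin N → Fin N → ℝ≥0∞} (hg : ∀ i j, Measurable fun w => g w i j)
    {δ : ℝ} (hδ : 0 ≤ δ) (m : ℕ) :
    ∫⁻ z, Φ.collisionPairSum (Ioc 0 (((m : ℝ) + 1) * δ)) (fun _ w i j => g w i j) z
        ∂(liouville (Torus.geometry d) N ε) =
      ((m : ℝ≥0∞) + 1) *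
        ∫⁻ z, Φ.collisionPairSum (Ioc 0 δ) (fun _ w i j => g w i j) z ∂(liouville (Torus.geometry d) N ε) := by
  set μ := liouville (Torus.geometry d) N ε with hμ
  have hAEM : AEMeasurable (Φ.collisionPairSum (Ioc 0 δ) (fun _ w i j => g w i j)) μ :=
    aemeasurable_collisionPairSum hε hε' Φ g hg δ
  have h1 : ∫⁻ z, Φ.collisionPairSum (Ioc 0 (((m : ℝ) + 1) * δ)) (fun _ w i j => g w i j) z ∂μ =
      ∫⁻ z, ∑ w ∈ Finset.range (m + 1),
        Φ.collisionPairSum (Ioc 0 δ) (fun _ w i j => g w i j) (Φ.flow ((w : ℝ) * δ) z) ∂μ := by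
    refine lintegral_congr_ae ?_
    filter_upwards [Φ.ae_mem_good] with z hz
    exact collisionPairSum_windows Φ hz hδ m g
  have hcomp : ∀ w : ℕ, AEMeasurable
      (fun z => Φ.collisionPairSum (Ioc 0 δ) (fun _ w i j => g w i j) (Φ.flow ((w : ℝ) * δ) z)) μ :=
    fun w => hAEM.comp_quasiMeasurePreserving (Φ.measurePreserving _).quasiMeasurePreserving
  rw [h1, lintegral_finsetSum' _ fun w _ => hcomp w]
  have h2 : ∀ w ∈ Finset.range (m + 1),
      ∫⁻ z, Φ.collisionPairSum (Ioc 0 δ) (fun _ w i j => g w i j) (Φ.flow ((w : ℝ) * δ) z) ∂μ =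
        ∫⁻ z, Φ.collisionPairSum (Ioc 0 δ) (fun _ w i j => g w i j) z ∂μ := by
    intro w _
    have hmp := Φ.measurePreserving ((w : ℝ) * δ)
    have hAEM' : AEMeasurable (Φ.collisionPairSum (Ioc 0 δ) (fun _ w i j => g w i j))
        (Measure.map (Φ.flow ((w : ℝ) * δ)) μ) := by rw [hmp.map_eq]; exact hAEM
    rw [← lintegral_map' hAEM' (Φ.measurable_flow _).aemeasurable, hmp.map_eq]
  rw [Finset.sum_congr rfl h2, Finset.sum_const, Finset.card_range, nsmul_eq_mul]
  push_cast
  ring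

/-! ### On one window the collision pair sum dominates the hit-piece marks -/

/-- **The hit pieces predict collisions**: for `ε > 0`, `ε + 2r < 1/2`, `2Vδ ≤ r`, `V, δ ≥ 0` and a good
datum `u`, the sum over the pairs `a < b` of the marks `g(w⁺,a,b) + g(w⁺,b,a)` of the collision
predicted when `u` lies in the hit piece of `(a, b)` on the shell is at most the collision pair sum of
`g` over `(0, δ]` (distinct ordered pairs have disjoint hit pieces,
`Alexander.eq_of_mem_hitPiece_of_mem_hitPiece`, and `collisionPairSum_ge_of_mem_hitPiece`). [folklore] -/
theorem campbell_sum_hitPiece_indicator_le_collisionPairSum {r δ V : ℝ} (hε : 0 < ε)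
    (hch : ε + 2 * r < 2⁻¹) (hr : 2 * V * δ ≤ r) (hV : 0 ≤ V) (hδ : 0 ≤ δ)
    (Φ : HardSphereFlow (Torus.geometry d) ε N) (g : Config N d (UnitAddTorus d) → Fin N → Fin N → ℝ≥0∞)
    {u : Config N d (UnitAddTorus d)} (hu : u ∈ Φ.good) :
    (∑ a : Fin N, ∑ b : Fin N, if a < b then
        (Alexander.hitPiece N ε r δ a b ∩ {u | configEnergy u ≤ V ^ 2 / 2}).indicator
          (fun u => g (collidePair (Torus.geometry d) a b
              (freeFlight (Torus.geometry d)
                (pairHitTime ε ((Torus.geometry d).sepVec (u a).1 (u b).1) ((u a).2 - (u b).2)) u)) a b +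
            g (collidePair (Torus.geometry d) a b
              (freeFlight (Torus.geometry d)
                (pairHitTime ε ((Torus.geometry d).sepVec (u a).1 (u b).1) ((u a).2 - (u b).2)) u)) b a) u
        else 0) ≤
      Φ.collisionPairSum (Ioc 0 δ) (fun _ w i j => g w i j) u := by
  classical
  by_cases hex : ∃ a b : Fin N, a < b ∧
      u ∈ Alexander.hitPiece N ε r δ a b ∩ {u | configEnergy u ≤ V ^ 2 / 2}
  · obtain ⟨a, b, hab, hmem⟩ := hex
    -- only the term `(a, b)` survives
    have huniq : ∀ a' b' : Fin N, a' < b' →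
        u ∈ Alexander.hitPiece N ε r δ a' b' ∩ {u | configEnergy u ≤ V ^ 2 / 2} → a' = a ∧ b' = b :=
      fun a' b' hab' hmem' => Alexander.eq_of_mem_hitPiece_of_mem_hitPiece hab hab' hmem.1 hmem'.1
    rw [Finset.sum_eq_single a, Finset.sum_eq_single b, if_pos hab, indicator_of_mem hmem]
    · exact collisionPairSum_ge_of_mem_hitPiece hε hch hr hV hδ Φ hab hu hmem.1 hmem.2 g
    · intro b' _ hb'
      by_cases hab' : a < b'
      · rw [if_pos hab', indicator_of_notMem]
        intro hmem'
        exact hb' (huniq a b' hab' hmem').2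
      · rw [if_neg hab']
    · intro h; exact absurd (Finset.mem_univ b) h
    · intro a' _ ha'
      refine Finset.sum_eq_zero fun b' _ => ?_
      by_cases hab' : a' < b'
      · rw [if_pos hab', indicator_of_notMem]
        intro hmem'
        exact ha' (huniq a' b' hab' hmem').1
      · rw [if_neg hab']
    · intro h; exact absurd (Finset.mem_univ a) h
  · -- no hit piece contains `u`: the sum vanishes
    push Not at hex
    refine le_of_eq_of_le (Finset.sum_eq_zero fun a _ => Finset.sum_eq_zero fun b _ => ?_) bot_le
    by_cases hab : a < b
    · rw [if_pos hab, indicator_of_notMem (hex a b hab)]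
    · rw [if_neg hab]

/-! ### The Liouville integral of a hit-piece indicator -/

/-- On subsets of the hard-sphere domain the Liouville integral of an indicator is the Lebesgue one.
[folklore] -/
theorem campbell_lintegral_indicator_liouville {S : Set (Config N d (UnitAddTorus d))}
    (hS : MeasurableSet S) (hSD : S ⊆ hardSphereDomain (Torus.geometry d) N ε)
    (f : Config N d (UnitAddTorus d) → ℝ≥0∞) :
    ∫⁻ u, S.indicator f u ∂(liouville (Torus.geometry d) N ε) = ∫⁻ u, S.indicator f u := by
  rw [liouville_eq, lintegral_indicator hS, lintegral_indicator hS, Measure.restrict_restrict hS,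
    inter_eq_left.2 hSD]

/-! ### The lower bound at a fixed mesh -/

/-- **The lower bound at mesh `δ = τ/(m+1)`.** For `0 < ε < 1/2`, a hard-sphere flow structure `Φ` on
`(T^d × ℝ^d)^N`, a measurable mark `g ≥ 0`, `τ > 0`, `V ≥ 0` and `m` with `ε + 8Vτ/(m+1) < 1/2`:
`τ · Σ_{a<b} ∫ dz ∫ dω ε^{d-1}⟪ω, v_a − v_b⟫ (1_{E ≤ V²/2, others farther than ε + 8Vδ} (g(·,a,b) + g(·,b,a)))(z^{ab}_ω)
  ≤ ∫ CPS_{(0,τ]}(g) dLiouville` (`δ = τ/(m+1)`, room `r = 2Vδ`). [cite: CIP1994, App. 4.A pp. 107–111] -/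
theorem campbell_lowerBound_mesh (hε : 0 < ε) (hε' : ε < 1 / 2)
    (Φ : HardSphereFlow (Torus.geometry d) ε N)
    {g : Config N d (UnitAddTorus d) → Fin N → Fin N → ℝ≥0∞} (hg : ∀ i j, Measurable fun w => g w i j)
    {τ : ℝ} (hτ : 0 < τ) {V : ℝ} (hV : 0 ≤ V) (m : ℕ)
    (hch : ε + 2 * (2 * V * (τ / ((m : ℝ) + 1))) < 2⁻¹) :
    ENNReal.ofReal τ * ∑ a : Fin N, ∑ b : Fin N, (if a < b then
        ∫⁻ z : Config N d (UnitAddTorus d), ∫⁻ ω : Metric.sphere (0 : EuclideanSpace ℝ d) 1,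
          ENNReal.ofReal (ε ^ (Fintype.card d - 1) * ⟪((ω : EuclideanSpace ℝ d)), (z a).2 - (z b).2⟫) *
            {w : Config N d (UnitAddTorus d) | configEnergy w ≤ V ^ 2 / 2 ∧
                Alexander.OthersFar ε (2 * (2 * V * (τ / ((m : ℝ) + 1)))) w a b}.indicator
              (fun w => g w a b + g w b a) (contactInsert ε a b (ω : EuclideanSpace ℝ d) z)
          ∂(volume : Measure (EuclideanSpace ℝ d)).toSphere
        else 0) ≤
      ∫⁻ z, Φ.collisionPairSum (Ioc 0 τ) (fun _ w i j => g w i j) z ∂(liouville (Torus.geometry d) N ε) := by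
  set δ : ℝ := τ / ((m : ℝ) + 1) with hδdef
  set r : ℝ := 2 * V * δ with hrdef
  have hm : (0 : ℝ) < (m : ℝ) + 1 := by positivity
  have hδ : 0 < δ := div_pos hτ hm
  have hτδ : ((m : ℝ) + 1) * δ = τ := by rw [hδdef]; field_simp
  have hr0 : 0 ≤ r := by positivity
  have hG : ∀ a b : Fin N, Measurable fun w : Config N d (UnitAddTorus d) => g w a b + g w b a :=
    fun a b => (hg a b).add (hg b a)
  -- stationarity
  have hwin := campbell_lintegral_collisionPairSum_windows hε hε' Φ hg hδ.le m
  rw [hτδ] at hwin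
  -- one window
  have hone : (∑ a : Fin N, ∑ b : Fin N, if a < b then ENNReal.ofReal δ *
      ∫⁻ z : Config N d (UnitAddTorus d), ∫⁻ ω : Metric.sphere (0 : EuclideanSpace ℝ d) 1,
        ENNReal.ofReal (ε ^ (Fintype.card d - 1) * ⟪((ω : EuclideanSpace ℝ d)), (z a).2 - (z b).2⟫) *
          {w : Config N d (UnitAddTorus d) | configEnergy w ≤ V ^ 2 / 2 ∧
              Alexander.OthersFar ε (2 * r) w a b}.indicator
            (fun w => g w a b + g w b a) (contactInsert ε a b (ω : EuclideanSpace ℝ d) z)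
        ∂(volume : Measure (EuclideanSpace ℝ d)).toSphere else 0) ≤
      ∫⁻ u, Φ.collisionPairSum (Ioc 0 δ) (fun _ w i j => g w i j) u ∂(liouville (Torus.geometry d) N ε) := by
    calc (∑ a : Fin N, ∑ b : Fin N, if a < b then ENNReal.ofReal δ *
          ∫⁻ z : Config N d (UnitAddTorus d), ∫⁻ ω : Metric.sphere (0 : EuclideanSpace ℝ d) 1,
            ENNReal.ofReal (ε ^ (Fintype.card d - 1) * ⟪((ω : EuclideanSpace ℝ d)), (z a).2 - (z b).2⟫) *
              {w : Config N d (UnitAddTorus d) | configEnergy w ≤ V ^ 2 / 2 ∧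
                  Alexander.OthersFar ε (2 * r) w a b}.indicator
                (fun w => g w a b + g w b a) (contactInsert ε a b (ω : EuclideanSpace ℝ d) z)
            ∂(volume : Measure (EuclideanSpace ℝ d)).toSphere else 0)
        ≤ ∑ a : Fin N, ∑ b : Fin N, (if a < b then
            ∫⁻ u, (Alexander.hitPiece N ε r δ a b ∩ {u | configEnergy u ≤ V ^ 2 / 2}).indicator
              (fun u => g (collidePair (Torus.geometry d) a b
                  (freeFlight (Torus.geometry d)
                    (pairHitTime ε ((Torus.geometry d).sepVec (u a).1 (u b).1) ((u a).2 - (u b).2)) u)) a b +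
                g (collidePair (Torus.geometry d) a b
                  (freeFlight (Torus.geometry d)
                    (pairHitTime ε ((Torus.geometry d).sepVec (u a).1 (u b).1) ((u a).2 - (u b).2)) u)) b a) u
              ∂(liouville (Torus.geometry d) N ε) else 0) := by
          refine Finset.sum_le_sum fun a _ => Finset.sum_le_sum fun b _ => ?_
          by_cases hab : a < b
          · rw [if_pos hab, if_pos hab]
            have hS : MeasurableSet (Alexander.hitPiece N ε r δ a b ∩
                {u : Config N d (UnitAddTorus d) | configEnergy u ≤ V ^ 2 / 2}) :=
              (Alexander.measurableSet_hitPiece ε r δ a b).inter (Alexander.measurableSet_energyShell _)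
            have hSD : Alexander.hitPiece N ε r δ a b ∩
                {u : Config N d (UnitAddTorus d) | configEnergy u ≤ V ^ 2 / 2} ⊆
                hardSphereDomain (Torus.geometry d) N ε :=
              fun u hu' => Alexander.hitPiece_subset_hardSphereDomain hr0 a b hu'.1
            rw [campbell_lintegral_indicator_liouville hS hSD]
            have h := campbell_lintegral_hitPiece_shell_ge (d := d) hε hch le_rfl hV hδ.le hab.ne (hG a b)
            beta_reduce at h
            exact h
          · rw [if_neg hab, if_neg hab]
      _ = ∫⁻ u, ∑ a : Fin N, ∑ b : Fin N, (if a < b then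
            (Alexander.hitPiece N ε r δ a b ∩ {u | configEnergy u ≤ V ^ 2 / 2}).indicator
              (fun u => g (collidePair (Torus.geometry d) a b
                  (freeFlight (Torus.geometry d)
                    (pairHitTime ε ((Torus.geometry d).sepVec (u a).1 (u b).1) ((u a).2 - (u b).2)) u)) a b +
                g (collidePair (Torus.geometry d) a b
                  (freeFlight (Torus.geometry d)
                    (pairHitTime ε ((Torus.geometry d).sepVec (u a).1 (u b).1) ((u a).2 - (u b).2)) u)) b a) u
              else 0) ∂(liouville (Torus.geometry d) N ε) := by
          rw [lintegral_finsetSum _ fun a _ => ?_]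
          · refine Finset.sum_congr rfl fun a _ => ?_
            rw [lintegral_finsetSum _ fun b _ => ?_]
            · refine Finset.sum_congr rfl fun b _ => ?_
              by_cases hab : a < b
              · simp only [if_pos hab]
              · simp only [if_neg hab, lintegral_const, zero_mul]
            · by_cases hab : a < b
              · simp only [if_pos hab]
                have h := campbell_measurable_hitPieceIntegrand (d := d) ε r δ V a b (hG a b)
                beta_reduce at h
                exact h
              · simp only [if_neg hab]
                exact measurable_const
          · refine Finset.measurable_sum _ fun b _ => ?_
            by_cases hab : a < b
            · simp only [if_pos hab]
              have h := campbell_measurable_hitPieceIntegrand (d := d) ε r δ V a b (hG a b)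
              beta_reduce at h
              exact h
            · simp only [if_neg hab]
              exact measurable_const
      _ ≤ _ := by
          refine lintegral_mono_ae ?_
          filter_upwards [Φ.ae_mem_good] with u hu
          exact campbell_sum_hitPiece_indicator_le_collisionPairSum hε hch le_rfl hV hδ.le Φ g hu
  -- assembling
  have hτeq : ENNReal.ofReal τ = ((m : ℝ≥0∞) + 1) * ENNReal.ofReal δ := by
    rw [← hτδ, ENNReal.ofReal_mul hm.le]
    congr 1
    rw [ENNReal.ofReal_add (Nat.cast_nonneg m) zero_le_one, ENNReal.ofReal_natCast, ENNReal.ofReal_one]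
  rw [hwin, hτeq, mul_assoc, Finset.mul_sum]
  refine mul_le_mul' le_rfl (le_trans (le_of_eq ?_) hone)
  refine Finset.sum_congr rfl fun a _ => ?_
  rw [Finset.mul_sum]
  refine Finset.sum_congr rfl fun b _ => ?_
  by_cases hab : a < b
  · rw [if_pos hab, if_pos hab]
  · rw [if_neg hab, if_neg hab, mul_zero]

end

end Literature.MathematicalPhysics.KineticTheory
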